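import Literature.NumberTheory.Automorphic.TorusCharacters
import HarnessLib

/-!
# The torus with prescribed character group acting through weights (Springer 3.2)

Trunk T-AUTOMORPHIC (G25 AutomorphicL); companion of `LinearAlgebraicGroups.lean`,
`LinearAlgebraicGroupsProofs.lean` and `TorusCharacters.lean` (namespace `Literature.Automorphic`,
concrete `k`-points vocabulary: `diagonalGL`, `diagonalSubgroup = 𝔻ₘ`, `IsAlgebraicSubgroup`,
`IsZConnected`, `IsTorusSubgroup`, the character group `characterLattice T = X*(T)`, the
cocharacter group `cocharacterLattice T = X_*(T)`, the pairing `charPairingInt`). This is the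
**torus half of a realization of a root datum** (the construction direction of Chevalley's
existence theorem, Springer, *Linear Algebraic Groups*, 2nd ed., 10.1.1, lang.S13 (c)
`Literature.NumberTheory.Automorphic.chevalley_existence`): given an abelian group `X` (the prescribed character group) and
weights `wt : m → X` of a representation on `kᵐ`, the *weight torus*

  `T_X = weightTorus k wt = {diag (χ (wt i))ᵢ | χ ∈ Hom(X, kˣ)} ≤ GL m k`

is the image of `Hom(X, kˣ)` acting diagonally through the weights. Everything is proved:

* `wtHom wt : ℤᵐ → X` (`a ↦ ∑ aᵢ wt i`) and the relations `ker (wtHom wt)` among the weights;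
  `weightTorusHom`, `weightTorus`, `weightTorus_le_diagonalSubgroup`, commutativity.
* **Equations** (`diagonalGL_mem_weightTorus_iff`, when the weights generate `X`): a diagonal
  matrix lies in `T_X` iff its entries satisfy the monomial relations `∏ dᵢ ^ aᵢ = 1`,
  `a ∈ ker (wtHom wt)` (the character `X ≅ ℤᵐ / ker → kˣ` is obtained by
  `AddMonoidHom.liftOfSurjective`); hence `isAlgebraicSubgroup_weightTorus` (Springer 3.2.10
  (4): closed subgroups of `𝔻ₘ` are cut out by characters), with the monomial characters of
  `𝔻ₘ` realised by coordinate polynomials (`diagChar_mem_characterLattice` of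
  `TorusCharacters.lean`).
* **Connectedness** (`isZConnected_weightTorus`, `isTorusSubgroup_weightTorus`, for `X` free and
  `k` algebraically closed): an algebraic subgroup of finite index `N` contains all `N`-th powers,
  and every `χ ∈ Hom(X, kˣ)` is an `N`-th power (`exists_pow_eq_char`: `N`-th roots of its values
  on a `ℤ`-basis, Mathlib `Module.Free.chooseBasis`, `Module.Basis.constr`) — the argument of
  `eq_diagonalSubgroup_of_finiteIndex` (`LinearAlgebraicGroupsProofs.lean`, Springer 2.2.2 (1))
  for `𝔻ₘ`.
* **Characters** (`charEquiv k hwt : X*(T_X) ≃ X` for `X` finitely generated free and `k`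
  infinite): `x ↦ evalChar k hwt x = (t ↦ χ_t(x))` (`charOfMem`: the character underlying
  `t ∈ T_X`, `MonoidHom.ofInjective`) is a monomial character (`evalChar_wtHom`), hence
  algebraic; it is surjective onto `X*(T_X)` by Springer 3.2.3 (`weightHom_surjective` of
  `TorusCharacters.lean`: characters of subgroups of `𝔻ₘ` are monomial) and injective because
  the characters `X → kˣ` separate points (`exists_char_apply_ne_one`: `c ^ e ≠ 1` for some unit
  `c` when `e ≠ 0`, `zpowGroupHom_units_injective`).
* **Cocharacters and the pairing** (`cocharEquiv k wt hwt : X_*(T_X) ≃ Hom(X, ℤ)`,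
  `charPairingInt_evalChar_evalCochar : ⟨χ_x, λ_y⟩ = y(x)`, `k` infinite): `y ↦ evalCochar k wt y`
  (`c ↦ diag (c ^ y(wt i))`, via `cocharOfVec`) is injective, and surjective because the exponent
  vector `a` of an algebraic cocharacter (Springer 3.2.2, `coweightOf`,
  `mem_range_coweightHom_iff`) kills the relations (`∑ aᵢ rᵢ = 0` from `diag (c ^ aᵢ) ∈ T_X`),
  hence descends to `y ∈ Hom(X, ℤ)`; the pairing is `charPairingInt_diagChar` (3.2.11 (i)).

With a root datum `(X, R, Y, R^∨)` and a representation whose weights generate `X`, this gives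
the maximal-torus data `T`, `eX : X*(T) ≃ X`, `eY : X_*(T) ≃ Y` (through `Y ≅ Hom(X, ℤ)`) and the
clause `pairing_eq` of `IsRootDatumOf`; the root subgroups come from
`NilpotentExpRootHom.lean`.

## Mathlib

`MonoidHom.ofInjective`, `MonoidHom.eval`, `AddMonoidHom.liftOfSurjective` /
`liftOfRightInverse_comp_apply`, `AddMonoidHom.toMultiplicativeLeft`, `Module.Free.chooseBasis`,
`Module.Basis.constr`, `Module.Basis.ext`, `IsAlgClosed.exists_pow_nat_eq`,
`Subgroup.pow_index_mem`, `AddEquiv.ofBijective`. Mathlib has no algebraic tori or character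
groups of matrix groups; nothing here duplicates a Mathlib declaration (the tree's
`TorusCharacters.lean` treats subgroups of `𝔻ₘ` in general; this file is the special family
`T_X`).

## References

* [SpringerLAG1998] T. A. Springer, *Linear Algebraic Groups*, 2nd ed., Progress in Mathematics 9,
  Birkhäuser (1998): 2.2.2 (1), 3.2.1–3.2.3, 3.2.7, 3.2.10 (4), 3.2.11 (i), 10.1.1.
-/

noncomputable section

open scoped MatrixGroups IsMulCommutative

namespace Literature.NumberTheory.Automorphic

variable {k : Type*} [Field k] {m : Type*} [Fintype m]
variable {X : Type*} [AddCommGroup X]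

/-! ### The weight map and the relations among the weights -/

/-- The weight map on exponent vectors: `a ↦ ∑ᵢ aᵢ • wt i`, `ℤᵐ → X`. [folklore] -/
def wtHom (wt : m → X) : (m → ℤ) →+ X where
  toFun a := ∑ i, a i • wt i
  map_zero' := by simp
  map_add' a b := by simp [add_zsmul, Finset.sum_add_distrib]

variable {wt : m → X}

/-- Unfolding of `wtHom`. [folklore] -/
lemma wtHom_apply (a : m → ℤ) : wtHom wt a = ∑ i, a i • wt i := rfl

/-- A character of `X` evaluated at `∑ aᵢ wt i` is the monomial `∏ χ(wt i) ^ aᵢ`. [folklore] -/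
lemma apply_ofAdd_wtHom (χ : Multiplicative X →* kˣ) (a : m → ℤ) :
    χ (Multiplicative.ofAdd (wtHom wt a)) = ∏ i, χ (Multiplicative.ofAdd (wt i)) ^ a i := by
  rw [wtHom_apply, ofAdd_sum, map_prod]
  refine Finset.prod_congr rfl fun i _ => ?_
  rw [ofAdd_zsmul, map_zpow]

/-- The relations among the weights hold for the values of any character. [folklore] -/
lemma prod_zpow_eq_one_of_mem_ker (χ : Multiplicative X →* kˣ) {a : m → ℤ}
    (ha : a ∈ (wtHom wt).ker) : ∏ i, χ (Multiplicative.ofAdd (wt i)) ^ a i = 1 := by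
  rw [← apply_ofAdd_wtHom, (AddMonoidHom.mem_ker).mp ha, ofAdd_zero, map_one]

variable [DecidableEq m]

/-- `wtHom (eᵢ) = wt i`. [folklore] -/
lemma wtHom_single (i : m) : wtHom wt (Pi.single i 1) = wt i := by
  rw [wtHom_apply, Finset.sum_eq_single i (fun j _ hj => by simp [hj]) (by simp)]
  simp

/-! ### The weight torus -/

section Defs

variable (k) (wt : m → X)

/-- Evaluating a character `χ : X → kˣ` on the weights: `χ ↦ (χ (wt i))ᵢ`. [folklore] -/
def evalWeights : (Multiplicative X →* kˣ) →* (m → kˣ) where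
  toFun χ := fun i => χ (Multiplicative.ofAdd (wt i))
  map_one' := rfl
  map_mul' _ _ := rfl

/-- The homomorphism `Hom(X, kˣ) → GL m k`, `χ ↦ diag (χ (wt i))ᵢ`: the torus with character
group `X` acting on `kᵐ` through the weights `wt`. [folklore] -/
def weightTorusHom : (Multiplicative X →* kˣ) →* GL m k :=
  (diagonalGL m k).comp (evalWeights k wt)

/-- The *weight torus* `T_X ≤ GL m k` of the weights `wt : m → X`: the image of `Hom(X, kˣ)`
acting diagonally, `χ ↦ diag (χ (wt i))ᵢ` (Springer 3.2: the torus with character group `X`,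
in the representation with weights `wt`). [folklore] -/
def weightTorus : Subgroup (GL m k) :=
  (weightTorusHom k wt).range

end Defs

/-- Unfolding of `weightTorusHom`. [folklore] -/
lemma weightTorusHom_apply (χ : Multiplicative X →* kˣ) :
    weightTorusHom k wt χ = diagonalGL m k (fun i => χ (Multiplicative.ofAdd (wt i))) := rfl

/-- The weight torus is diagonal. [folklore] -/
lemma weightTorus_le_diagonalSubgroup : weightTorus k wt ≤ diagonalSubgroup m k := by
  rintro _ ⟨χ, rfl⟩
  exact ⟨_, rfl⟩

/-- The weight torus is commutative (it is diagonal). [folklore] -/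
instance isMulCommutative_weightTorus : IsMulCommutative ↥(weightTorus k wt) :=
  ⟨⟨fun a b => by
    apply Subtype.ext
    change (a : GL m k) * b = b * a
    have h := (isMulCommutative_diagonalSubgroup (n := m) (k := k)).is_comm.comm
      ⟨(a : GL m k), weightTorus_le_diagonalSubgroup a.2⟩
      ⟨(b : GL m k), weightTorus_le_diagonalSubgroup b.2⟩
    simpa using congrArg Subtype.val h⟩⟩

/-! ### The weight torus is cut out by the relations among the weights -/

section Relations

variable (hwt : Function.Surjective (wtHom wt))
include hwt

/-- The monomial map `a ↦ ∏ dᵢ ^ aᵢ` of a diagonal matrix satisfying the relations among the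
weights descends to a character of `X`. [folklore] -/
lemma exists_char_of_relations {d : m → kˣ} (hd : ∀ a ∈ (wtHom wt).ker, ∏ i, d i ^ a i = 1) :
    ∃ χ : Multiplicative X →* kˣ, ∀ i, χ (Multiplicative.ofAdd (wt i)) = d i := by
  let ψ : (m → ℤ) →+ Additive kˣ :=
    { toFun := fun a => Additive.ofMul (∏ i, d i ^ a i)
      map_zero' := by simp
      map_add' := fun a b => by
        rw [← ofMul_mul, ← Finset.prod_mul_distrib]
        congr 1
        exact Finset.prod_congr rfl fun i _ => by rw [Pi.add_apply, zpow_add] }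
  have hψ : (wtHom wt).ker ≤ ψ.ker := fun a ha => by
    rw [AddMonoidHom.mem_ker]
    change Additive.ofMul (∏ i, d i ^ a i) = 0
    rw [hd a ha, ofMul_one]
  let χa : X →+ Additive kˣ := (wtHom wt).liftOfSurjective hwt ⟨ψ, hψ⟩
  refine ⟨AddMonoidHom.toMultiplicativeLeft χa, fun i => ?_⟩
  change Additive.toMul (χa (wt i)) = d i
  rw [← wtHom_single (wt := wt) i, AddMonoidHom.liftOfRightInverse_comp_apply]
  change Additive.toMul (Additive.ofMul (∏ l, d l ^ (Pi.single i (1 : ℤ) : m → ℤ) l)) = d i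
  rw [toMul_ofMul, prod_zpow_single]

/-- **Membership in the weight torus**: if the weights generate `X`, a diagonal matrix lies in
`T_X` iff its entries satisfy the relations among the weights. [folklore] -/
theorem diagonalGL_mem_weightTorus_iff (d : m → kˣ) :
    diagonalGL m k d ∈ weightTorus k wt ↔ ∀ a ∈ (wtHom wt).ker, ∏ i, d i ^ a i = 1 := by
  constructor
  · rintro ⟨χ, hχ⟩ a ha
    rw [weightTorusHom_apply] at hχ
    have hd : (fun i => χ (Multiplicative.ofAdd (wt i))) = d := diagonalGL_injective hχ
    rw [← hd]
    exact prod_zpow_eq_one_of_mem_ker χ ha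
  · intro hd
    obtain ⟨χ, hχ⟩ := exists_char_of_relations hwt hd
    exact ⟨χ, by rw [weightTorusHom_apply]; congr 1; funext i; exact hχ i⟩

/-- **The weight torus is an algebraic subgroup**: it is cut out, inside the diagonal torus, by the
monomial equations `∏ xᵢᵢ ^ aᵢ = 1` for the relations `a` among the weights (Springer 3.2.10
(4)). [cite: SpringerLAG1998, 3.2.10 (4)] -/
theorem isAlgebraicSubgroup_weightTorus : IsAlgebraicSubgroup (weightTorus k wt) := by
  classical
  obtain ⟨S₀, hS₀⟩ := isAlgebraicSubgroup_diagonalSubgroup (n := m) (k := k)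
  -- the polynomial of the monomial character of the full diagonal torus
  have hp : ∀ a : m → ℤ, ∃ p : MvPolynomial (GLCoord m) k,
      ∀ t : ↥(diagonalSubgroup m k), ((diagChar le_rfl a t : kˣ) : k) =
        MvPolynomial.eval (glCoordFun (t : GL m k)) p :=
    fun a => diagChar_mem_characterLattice (le_refl (diagonalSubgroup m k)) a
  choose p hp using hp
  refine ⟨S₀ ∪ Set.range (fun a : (wtHom wt).ker => p a.1 - MvPolynomial.C 1), ?_⟩
  ext g
  simp only [SetLike.mem_coe, zeroLocusGL, Set.mem_setOf_eq, Set.mem_union, Set.mem_range]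
  constructor
  · rintro ⟨χ, rfl⟩ q hq
    rcases hq with hq | ⟨a, rfl⟩
    · have hmem : weightTorusHom k wt χ ∈ (diagonalSubgroup m k : Set (GL m k)) :=
        weightTorus_le_diagonalSubgroup ⟨χ, rfl⟩
      rw [hS₀] at hmem
      exact hmem q hq
    · rw [map_sub, MvPolynomial.eval_C, sub_eq_zero,
        ← hp a.1 ⟨weightTorusHom k wt χ, weightTorus_le_diagonalSubgroup ⟨χ, rfl⟩⟩,
        diagChar_apply]
      have hco : diagCoord (le_refl (diagonalSubgroup m k))
          ⟨weightTorusHom k wt χ, weightTorus_le_diagonalSubgroup ⟨χ, rfl⟩⟩ =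
          fun i => χ (Multiplicative.ofAdd (wt i)) :=
        diagonalGL_injective (by rw [diagonalGL_diagCoord]; rfl)
      rw [hco]
      beta_reduce
      rw [prod_zpow_eq_one_of_mem_ker χ a.2, Units.val_one]
  · intro hg
    have hg₀ : g ∈ (diagonalSubgroup m k : Set (GL m k)) := by
      rw [hS₀]
      exact fun q hq => hg q (Or.inl hq)
    obtain ⟨d, rfl⟩ := hg₀
    rw [diagonalGL_mem_weightTorus_iff hwt]
    intro a ha
    have h := hg _ (Or.inr ⟨⟨a, ha⟩, rfl⟩)
    rw [map_sub, MvPolynomial.eval_C, sub_eq_zero, ← hp a ⟨diagonalGL m k d, d, rfl⟩,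
      diagChar_apply] at h
    have hco : diagCoord (le_refl (diagonalSubgroup m k)) ⟨diagonalGL m k d, d, rfl⟩ = d :=
      diagonalGL_injective (by rw [diagonalGL_diagCoord])
    rw [hco] at h
    exact Units.val_eq_one.mp h

end Relations

/-! ### Connectedness: the weight torus of a free lattice is a torus -/

section Torus

variable [Module.Free ℤ X]

/-- Every character of a free abelian group `X` with values in `kˣ`, `k` algebraically closed, is
an `N`-th power (`N ≥ 1`): take `N`-th roots of its values on a basis. [folklore] -/
lemma exists_pow_eq_char [IsAlgClosed k] (χ : Multiplicative X →* kˣ) {N : ℕ} (hN : 0 < N) :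
    ∃ χ' : Multiplicative X →* kˣ, χ' ^ N = χ := by
  let b := Module.Free.chooseBasis ℤ X
  have hroot : ∀ j, ∃ r : kˣ, r ^ N = χ (Multiplicative.ofAdd (b j)) := by
    intro j
    obtain ⟨z, hz⟩ := IsAlgClosed.exists_pow_nat_eq ((χ (Multiplicative.ofAdd (b j)) : kˣ) : k) hN
    have hz0 : z ≠ 0 := fun h0 =>
      (χ (Multiplicative.ofAdd (b j))).ne_zero (by rw [← hz, h0, zero_pow hN.ne'])
    exact ⟨Units.mk0 z hz0, Units.ext (by simp [hz])⟩
  choose r hr using hroot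
  let χ'a : X →ₗ[ℤ] Additive kˣ := b.constr ℤ fun j => Additive.ofMul (r j)
  refine ⟨AddMonoidHom.toMultiplicativeLeft χ'a.toAddMonoidHom, ?_⟩
  -- two characters agreeing on the basis
  have key : (N • χ'a) = (AddMonoidHom.toMultiplicativeLeft.symm χ).toIntLinearMap := by
    refine b.ext fun j => ?_
    rw [LinearMap.smul_apply, Module.Basis.constr_basis]
    change N • Additive.ofMul (r j) = Additive.ofMul (χ (Multiplicative.ofAdd (b j)))
    rw [← ofMul_pow, hr j]
  refine MonoidHom.ext fun x => ?_
  have h := LinearMap.congr_fun key (Multiplicative.toAdd x)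
  simp only [LinearMap.smul_apply] at h
  rw [MonoidHom.pow_apply]
  change ((Additive.toMul (χ'a (Multiplicative.toAdd x))) ^ N : kˣ) = χ x
  rw [← toMul_nsmul, h]
  rfl

variable (hwt : Function.Surjective (wtHom wt))
include hwt

/-- **The weight torus of a free lattice is Zariski-connected** (over an algebraically closed
field): an algebraic subgroup of finite index `N` contains all `N`-th powers, and every element
of `T_X ≅ Hom(X, kˣ)` is an `N`-th power (Springer 2.2.2 (1), 3.2.7 for `𝔻ₙ`). [folklore] -/
theorem isZConnected_weightTorus [IsAlgClosed k] : IsZConnected (weightTorus k wt) := by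
  refine ⟨isAlgebraicSubgroup_weightTorus hwt, fun H hH _ hfi => le_antisymm hH ?_⟩
  rintro _ ⟨χ, rfl⟩
  set K : Subgroup ↥(weightTorus k wt) := H.subgroupOf (weightTorus k wt)
  have hN : 0 < K.index := Nat.pos_of_ne_zero hfi.index_ne_zero
  obtain ⟨χ', hχ'⟩ := exists_pow_eq_char χ hN
  have hmem : (⟨weightTorusHom k wt χ', χ', rfl⟩ : ↥(weightTorus k wt)) ^ K.index ∈ K :=
    K.pow_index_mem _
  have hmem' := Subgroup.mem_subgroupOf.mp hmem
  rwa [Subgroup.coe_pow, ← map_pow, hχ'] at hmem'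

/-- **The weight torus of a free lattice whose weights generate it is a torus** (Zariski-connected,
commutative, semisimple elements). [cite: SpringerLAG1998, 3.2.7] -/
theorem isTorusSubgroup_weightTorus [IsAlgClosed k] : IsTorusSubgroup (weightTorus k wt) :=
  ⟨isZConnected_weightTorus hwt, isMulCommutative_weightTorus,
    fun _ hg => isSemisimpleElt_of_mem_diagonalSubgroup (weightTorus_le_diagonalSubgroup hg)⟩

end Torus


/-! ### The character group of the weight torus is `X` -/

section Characters

variable {wt : m → X}

/-- The weight torus homomorphism `Hom(X, kˣ) → GL m k` is injective when the weights generate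
`X`. [folklore] -/
lemma weightTorusHom_injective (hwt : Function.Surjective (wtHom wt)) :
    Function.Injective (weightTorusHom k wt) := by
  intro χ χ' h
  rw [weightTorusHom_apply, weightTorusHom_apply] at h
  have hi : ∀ i, χ (Multiplicative.ofAdd (wt i)) = χ' (Multiplicative.ofAdd (wt i)) :=
    fun i => congrFun (diagonalGL_injective h) i
  refine MonoidHom.ext fun x => ?_
  obtain ⟨a, ha⟩ := hwt (Multiplicative.toAdd x)
  rw [← ofAdd_toAdd x, ← ha, apply_ofAdd_wtHom, apply_ofAdd_wtHom]
  exact Finset.prod_congr rfl fun i _ => by rw [hi i]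

variable (k) in
/-- The character of `X` underlying an element of the weight torus (the inverse of the
isomorphism `Hom(X, kˣ) ≃ T_X`). [folklore] -/
def charOfMem (hwt : Function.Surjective (wtHom wt)) :
    ↥(weightTorus k wt) ≃* (Multiplicative X →* kˣ) :=
  (MonoidHom.ofInjective (weightTorusHom_injective (k := k) hwt)).symm

variable (hwt : Function.Surjective (wtHom wt))

/-- `charOfMem` inverts `weightTorusHom`. [folklore] -/
lemma charOfMem_weightTorusHom (χ : Multiplicative X →* kˣ) :
    charOfMem k hwt ⟨weightTorusHom k wt χ, χ, rfl⟩ = χ := by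
  change (MonoidHom.ofInjective (weightTorusHom_injective (k := k) hwt)).symm _ = χ
  apply (MulEquiv.symm_apply_eq _).mpr
  apply Subtype.ext
  exact (MonoidHom.ofInjective_apply _).symm

/-- `weightTorusHom` inverts `charOfMem`. [folklore] -/
lemma weightTorusHom_charOfMem (t : ↥(weightTorus k wt)) :
    weightTorusHom k wt (charOfMem k hwt t) = (t : GL m k) := by
  obtain ⟨_, χ, rfl⟩ := t
  rw [charOfMem_weightTorusHom]

variable (k) in
/-- The character `t ↦ χ_t(x)` of the weight torus attached to `x ∈ X`. [folklore] -/
def evalChar (x : X) : ↥(weightTorus k wt) →* kˣ :=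
  (MonoidHom.eval (Multiplicative.ofAdd x)).comp (charOfMem k hwt).toMonoidHom

/-- Unfolding of `evalChar`. [folklore] -/
lemma evalChar_apply (x : X) (t : ↥(weightTorus k wt)) :
    evalChar k hwt x t = charOfMem k hwt t (Multiplicative.ofAdd x) := rfl

/-- `evalChar x` on `diag (χ (wt i))` is `χ(x)`. [folklore] -/
lemma evalChar_apply_mk (x : X) (χ : Multiplicative X →* kˣ) :
    evalChar k hwt x ⟨weightTorusHom k wt χ, χ, rfl⟩ = χ (Multiplicative.ofAdd x) := by
  rw [evalChar_apply, charOfMem_weightTorusHom]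

/-- The diagonal entries of `t ∈ T_X` are the values `χ_t (wt i)`. [folklore] -/
lemma diagCoord_weightTorus (t : ↥(weightTorus k wt)) (i : m) :
    diagCoord weightTorus_le_diagonalSubgroup t i =
      charOfMem k hwt t (Multiplicative.ofAdd (wt i)) := by
  have h : diagonalGL m k (diagCoord weightTorus_le_diagonalSubgroup t) =
      diagonalGL m k (fun i => charOfMem k hwt t (Multiplicative.ofAdd (wt i))) := by
    rw [diagonalGL_diagCoord, ← weightTorusHom_apply, weightTorusHom_charOfMem]
  exact congrFun (diagonalGL_injective h) i

/-- The character attached to `x = ∑ aᵢ wt i` is the monomial character `t ↦ ∏ tᵢᵢ ^ aᵢ`.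
[folklore] -/
lemma evalChar_wtHom (a : m → ℤ) :
    evalChar k hwt (wtHom wt a) = diagChar weightTorus_le_diagonalSubgroup a := by
  refine MonoidHom.ext fun t => ?_
  rw [evalChar_apply, apply_ofAdd_wtHom, diagChar_apply]
  exact Finset.prod_congr rfl fun i _ => by rw [diagCoord_weightTorus hwt]

/-- The characters `evalChar x` are algebraic (they are monomial characters). [folklore] -/
lemma isAlgebraicChar_evalChar (x : X) : IsAlgebraicChar (evalChar k hwt x) := by
  obtain ⟨a, rfl⟩ := hwt x
  rw [evalChar_wtHom hwt]
  exact diagChar_mem_characterLattice _ a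

variable (k) in
/-- The homomorphism `X → X*(T_X)`, `x ↦ (t ↦ χ_t(x))`. [folklore] -/
def evalCharHom : X →+ Additive ↥(characterLattice (weightTorus k wt)) where
  toFun x := Additive.ofMul ⟨evalChar k hwt x, isAlgebraicChar_evalChar hwt x⟩
  map_zero' := by
    apply Additive.toMul.injective
    apply Subtype.ext
    refine MonoidHom.ext fun t => ?_
    simp [evalChar_apply]
  map_add' x y := by
    apply Additive.toMul.injective
    apply Subtype.ext
    refine MonoidHom.ext fun t => ?_
    simp [evalChar_apply, ofAdd_add, map_mul]

/-- Unfolding of `evalCharHom`. [folklore] -/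
lemma coe_toMul_evalCharHom (x : X) :
    ((Additive.toMul (evalCharHom k hwt x) : ↥(characterLattice (weightTorus k wt))) :
      ↥(weightTorus k wt) →* kˣ) = evalChar k hwt x := rfl

/-- `evalCharHom ∘ wtHom = weightHom`: on `∑ aᵢ wt i` the character is the monomial character.
[folklore] -/
lemma evalCharHom_wtHom (a : m → ℤ) :
    evalCharHom k hwt (wtHom wt a) = weightHom weightTorus_le_diagonalSubgroup a := by
  apply Additive.toMul.injective
  apply Subtype.ext
  rw [coe_toMul_evalCharHom, evalChar_wtHom, coe_weightHom]

/-- **Every algebraic character of the weight torus comes from `X`** (Springer 3.2.3: characters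
of subgroups of `𝔻ₙ` are monomial). [cite: SpringerLAG1998, 3.2.3] -/
theorem evalCharHom_surjective : Function.Surjective (evalCharHom k hwt) := by
  intro c
  obtain ⟨a, ha⟩ := weightHom_surjective weightTorus_le_diagonalSubgroup c
  exact ⟨wtHom wt a, by rw [evalCharHom_wtHom, ha]⟩

variable [Module.Free ℤ X] [Module.Finite ℤ X]

omit [Fintype m] [DecidableEq m] hwt in
/-- Over an infinite field the characters `X → kˣ` of a finitely generated free abelian group
separate its points. [folklore] -/
lemma exists_char_apply_ne_one [Infinite k] {x : X} (hx : x ≠ 0) :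
    ∃ χ : Multiplicative X →* kˣ, χ (Multiplicative.ofAdd x) ≠ 1 := by
  classical
  let b := Module.Free.chooseBasis ℤ X
  obtain ⟨j, hj⟩ : ∃ j, b.repr x j ≠ 0 := by
    by_contra h
    push Not at h
    exact hx (b.repr.injective (by ext j; simp [h j]))
  -- a unit which is not a root of unity of order dividing the coordinate
  obtain ⟨c, hc⟩ : ∃ c : kˣ, c ^ b.repr x j ≠ 1 := by
    by_contra h
    push Not at h
    have h0 : (zpowGroupHom (b.repr x j) : kˣ →* kˣ) = zpowGroupHom 0 := by
      ext c : 1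
      simp [h c]
    exact hj (zpowGroupHom_units_injective h0)
  let χa : X →ₗ[ℤ] Additive kˣ := b.constr ℤ fun i => if i = j then Additive.ofMul c else 0
  refine ⟨AddMonoidHom.toMultiplicativeLeft χa.toAddMonoidHom, ?_⟩
  change Additive.toMul (χa x) ≠ 1
  have hx' : χa x = b.repr x j • Additive.ofMul c := by
    simp [χa, Module.Basis.constr_apply_fintype, Module.Basis.equivFun_apply, smul_ite]
  rw [hx', toMul_zsmul, toMul_ofMul]
  exact hc

/-- **`X → X*(T_X)` is injective** for a finitely generated free `X` over an infinite field.
[folklore] -/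
theorem evalCharHom_injective [Infinite k] : Function.Injective (evalCharHom k hwt) := by
  intro x y hxy
  by_contra hne
  obtain ⟨χ, hχ⟩ := exists_char_apply_ne_one (k := k) (sub_ne_zero.mpr hne)
  apply hχ
  have h := congrArg (fun c : Additive ↥(characterLattice (weightTorus k wt)) =>
    ((Additive.toMul c : ↥(characterLattice (weightTorus k wt))) : ↥(weightTorus k wt) →* kˣ)
      ⟨weightTorusHom k wt χ, χ, rfl⟩) hxy
  simp only [coe_toMul_evalCharHom, evalChar_apply_mk] at h
  rw [ofAdd_sub, map_div, h, div_self']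

variable (k) in
/-- **The character group of the weight torus is `X`**: `eX : X*(T_X) ≃ X`, inverse to
`x ↦ (t ↦ χ_t(x))` (Springer 3.2.3, 3.2.10). [cite: SpringerLAG1998, 3.2.3] -/
def charEquiv [Infinite k] : Additive ↥(characterLattice (weightTorus k wt)) ≃+ X :=
  (AddEquiv.ofBijective (evalCharHom k hwt)
    ⟨evalCharHom_injective hwt, evalCharHom_surjective hwt⟩).symm

/-- `charEquiv.symm = evalCharHom`. [folklore] -/
lemma charEquiv_symm_apply [Infinite k] (x : X) :
    (charEquiv k hwt).symm x = evalCharHom k hwt x := rfl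

/-- `charEquiv (evalCharHom x) = x`. [folklore] -/
lemma charEquiv_evalCharHom [Infinite k] (x : X) : charEquiv k hwt (evalCharHom k hwt x) = x :=
  (charEquiv k hwt).apply_symm_apply x

end Characters

/-! ### The cocharacter group of the weight torus is `Hom(X, ℤ)`, and the pairing -/

section Cocharacters

variable (wt : m → X)

omit [Fintype m] [DecidableEq m] in
/-- The character `x ↦ c ^ y(x)` of `X` attached to `c ∈ kˣ` and `y ∈ Hom(X, ℤ)`. [folklore] -/
def zpowChar (c : kˣ) (y : X →+ ℤ) : Multiplicative X →* kˣ where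
  toFun x := c ^ y (Multiplicative.toAdd x)
  map_one' := by simp
  map_mul' a b := by rw [toAdd_mul, map_add, zpow_add]

/-- `diag (c ^ y(wt i))` is the image of `zpowChar c y`. [folklore] -/
lemma weightTorusHom_zpowChar (c : kˣ) (y : X →+ ℤ) :
    weightTorusHom k wt (zpowChar c y) = diagonalGL m k (fun i => c ^ y (wt i)) := rfl

/-- `diag (c ^ y(wt i)) ∈ T_X`. [folklore] -/
lemma diagonalGL_zpow_mem (y : X →+ ℤ) (c : kˣ) :
    diagonalGL m k (fun i => c ^ y (wt i)) ∈ weightTorus k wt :=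
  ⟨zpowChar c y, weightTorusHom_zpowChar wt c y⟩

variable (k) in
/-- The cocharacter `c ↦ diag (c ^ y(wt i))` of the weight torus attached to `y ∈ Hom(X, ℤ)`.
[folklore] -/
def evalCochar (y : X →+ ℤ) : kˣ →* ↥(weightTorus k wt) :=
  cocharOfVec (fun i => y (wt i)) (diagonalGL_zpow_mem wt y)

/-- Unfolding of `evalCochar`. [folklore] -/
lemma coe_evalCochar_apply (y : X →+ ℤ) (c : kˣ) :
    ((evalCochar k wt y c : ↥(weightTorus k wt)) : GL m k) =
      diagonalGL m k (fun i => c ^ y (wt i)) := rfl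

/-- The cocharacters `evalCochar y` are algebraic. [folklore] -/
lemma isAlgebraicCochar_evalCochar (y : X →+ ℤ) : IsAlgebraicCochar (evalCochar k wt y) :=
  isAlgebraicCochar_cocharOfVec _ _

/-- `evalCochar y` as an element of `X_*(T_X)`. [folklore] -/
def evalCocharMem (y : X →+ ℤ) : ↥(cocharacterLattice (weightTorus k wt)) :=
  ⟨evalCochar k wt y, isAlgebraicCochar_evalCochar wt y⟩

/-- The exponent vector of `evalCochar y` is `(y (wt i))ᵢ`. [folklore] -/
lemma coweightOf_evalCocharMem [Infinite k] (y : X →+ ℤ) :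
    coweightOf weightTorus_le_diagonalSubgroup (evalCocharMem (k := k) wt y) = fun i => y (wt i) :=
  coweightOf_cocharOfVec _ _ _

variable (k) in
/-- The homomorphism `Hom(X, ℤ) → X_*(T_X)`, `y ↦ (c ↦ diag (c ^ y(wt i)))`. [folklore] -/
def evalCocharHom [Infinite k] : (X →+ ℤ) →+ Additive ↥(cocharacterLattice (weightTorus k wt)) where
  toFun y := Additive.ofMul (evalCocharMem (k := k) wt y)
  map_zero' := by
    apply coweightHom_injective (weightTorus_le_diagonalSubgroup (k := k) (wt := wt))
    rw [map_zero, coweightHom_apply, coweightOf_evalCocharMem]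
    rfl
  map_add' y y' := by
    apply coweightHom_injective (weightTorus_le_diagonalSubgroup (k := k) (wt := wt))
    rw [map_add, coweightHom_apply, coweightOf_evalCocharMem,
      coweightHom_apply, coweightHom_apply, coweightOf_evalCocharMem, coweightOf_evalCocharMem]
    rfl

/-- Unfolding of `evalCocharHom`. [folklore] -/
lemma evalCocharHom_apply [Infinite k] (y : X →+ ℤ) :
    evalCocharHom k wt y = Additive.ofMul (evalCocharMem (k := k) wt y) := rfl

/-- `Hom(X, ℤ) → X_*(T_X)` is injective when the weights generate `X` (over an infinite field).
[folklore] -/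
theorem evalCocharHom_injective [Infinite k] (hwt : Function.Surjective (wtHom wt)) :
    Function.Injective (evalCocharHom k wt) := by
  intro y y' h
  have h' := congrArg (fun γ => coweightOf weightTorus_le_diagonalSubgroup (Additive.toMul γ)) h
  simp only [evalCocharHom_apply, toMul_ofMul, coweightOf_evalCocharMem] at h'
  ext x
  obtain ⟨a, rfl⟩ := hwt x
  rw [wtHom_apply, map_sum, map_sum]
  exact Finset.sum_congr rfl fun i _ => by rw [map_zsmul, map_zsmul, congrFun h' i]

/-- **Every algebraic cocharacter of the weight torus comes from `Hom(X, ℤ)`**: its exponent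
vector `a` (Springer 3.2.2) satisfies `∑ aᵢ rᵢ = 0` for every relation `r` among the weights
(because `diag (c ^ aᵢ) ∈ T_X` for all `c`), hence is `(y (wt i))ᵢ` for a `y ∈ Hom(X, ℤ)`.
[cite: SpringerLAG1998, 3.2.2] -/
theorem evalCocharHom_surjective [Infinite k] (hwt : Function.Surjective (wtHom wt)) :
    Function.Surjective (evalCocharHom k wt) := by
  intro γ'
  set γ : ↥(cocharacterLattice (weightTorus k wt)) := Additive.toMul γ' with hγ
  set a : m → ℤ := coweightOf weightTorus_le_diagonalSubgroup γ with ha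
  -- `diag (c ^ a i) = γ c ∈ T_X`
  have hmem : ∀ c : kˣ, diagonalGL m k (fun i => c ^ a i) ∈ weightTorus k wt :=
    (mem_range_coweightHom_iff weightTorus_le_diagonalSubgroup a).mp ⟨Additive.ofMul γ, rfl⟩
  -- the functional `e ↦ ∑ aᵢ eᵢ` kills the relations
  let φ : (m → ℤ) →+ ℤ :=
    { toFun := fun e => ∑ i, a i * e i
      map_zero' := by simp
      map_add' := fun e e' => by simp [mul_add, Finset.sum_add_distrib] }
  have hφ : (wtHom wt).ker ≤ φ.ker := by
    intro r hr
    rw [AddMonoidHom.mem_ker]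
    change ∑ i, a i * r i = 0
    apply zpowGroupHom_units_injective (k := k)
    ext c : 1
    simp only [zpowGroupHom_apply, zpow_zero]
    have h := (diagonalGL_mem_weightTorus_iff hwt _).mp (hmem c) r hr
    rw [← h, zpow_finset_sum]
    exact Finset.prod_congr rfl fun i _ => by rw [zpow_mul]
  let y : X →+ ℤ := (wtHom wt).liftOfSurjective hwt ⟨φ, hφ⟩
  have hy : ∀ i, y (wt i) = a i := by
    intro i
    rw [← wtHom_single (wt := wt) i, AddMonoidHom.liftOfRightInverse_comp_apply]
    change ∑ l, a l * (Pi.single i (1 : ℤ) : m → ℤ) l = a i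
    simp [Pi.single_apply]
  refine ⟨y, ?_⟩
  apply coweightHom_injective (weightTorus_le_diagonalSubgroup (k := k) (wt := wt))
  rw [evalCocharHom_apply, coweightHom_apply, coweightOf_evalCocharMem]
  change (fun i => y (wt i)) = coweightHom _ (Additive.ofMul (Additive.toMul γ'))
  rw [coweightHom_apply, ← hγ, ← ha]
  funext i
  exact hy i

variable (k) in
/-- **The cocharacter group of the weight torus is `Hom(X, ℤ)`**: `X_*(T_X) ≃ Hom(X, ℤ)`
(Springer 3.2.2, 3.2.11 (i)). [cite: SpringerLAG1998, 3.2.11 (i)] -/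
def cocharEquiv [Infinite k] (hwt : Function.Surjective (wtHom wt)) :
    Additive ↥(cocharacterLattice (weightTorus k wt)) ≃+ (X →+ ℤ) :=
  (AddEquiv.ofBijective (evalCocharHom k wt)
    ⟨evalCocharHom_injective wt hwt, evalCocharHom_surjective wt hwt⟩).symm

/-- `cocharEquiv.symm = evalCocharHom`. [folklore] -/
lemma cocharEquiv_symm_apply [Infinite k] (hwt : Function.Surjective (wtHom wt)) (y : X →+ ℤ) :
    (cocharEquiv k wt hwt).symm y = evalCocharHom k wt y := rfl

/-- **The pairing of the weight torus is evaluation**: `⟨χ_x, λ_y⟩ = y(x)` (Springer 3.2.11 (i)).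
[cite: SpringerLAG1998, 3.2.11 (i)] -/
theorem charPairingInt_evalChar_evalCochar [Infinite k] (hwt : Function.Surjective (wtHom wt))
    (x : X) (y : X →+ ℤ) :
    charPairingInt (evalChar k hwt x) (evalCochar k wt y) = y x := by
  obtain ⟨a, rfl⟩ := hwt x
  rw [evalChar_wtHom hwt,
    show evalCochar k wt y = ((evalCocharMem (k := k) wt y : ↥(cocharacterLattice _)) :
      kˣ →* ↥(weightTorus k wt)) from rfl,
    charPairingInt_diagChar, coweightOf_evalCocharMem, wtHom_apply, map_sum]
  exact Finset.sum_congr rfl fun i _ => by rw [map_zsmul, smul_eq_mul, mul_comm]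

end Cocharacters

end Literature.NumberTheory.Automorphic
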